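import Summits.HodgeConjecture.HodgeConjecture.Theorems.F0P3cStCharTSEPNormOneOfHsplit   -- ★-to-be E1 row 73 («LH5» LH5-p02 g12): §NW `innerG_char_self_eq_one_of_hsplit_of_not_wild` (the `hsplit`-socket, junction letters, NOT-WILD token; over ★ 59-F ED. 2 ∕ ★ 72-NW)
import Summits.HodgeConjecture.HodgeConjecture.Theorems.F0P3cStCharTSLdsSelfExtSplit        -- ★ p853797 E1 row 68-H DATUM (F0P3b-p01 g26): `forall_smooth_selfExtension_split_of_mem_lds` («K4′ SPLIT @ DATUM»; over ★ 68-H ABS p853780, ★ 68-A∕B∕C∕γ′, ★ 46‴, ★ (O1) 2b, ★ 63-D, ★ 68-R) + `twist_trivial_apply`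
import Summits.HodgeConjecture.HodgeConjecture.Theorems.F0P3cStCharTSJetDatumHGL            -- ★-to-be (M5) (F0P2-p06 g23): `hGLd_cmBorel` (the open-cell jet datum `hGLd` of ★ 68-H at `cmBorelTriple L 3 v`; over ★ (O1)-D, ★ (O2) FILE B p853773)
import Summits.HodgeConjecture.HodgeConjecture.Theorems.F0P3cStCharTSAdditiveCharLine       -- ★ p853738 + ED. 2 ★ p853791 (L) (F0P2-p02 g27∕g28): `additive_weylConj_eq_neg` (`λ(ʷm) = −λ(m)` for additive `λ` with open kernel)
import Summits.HodgeConjecture.HodgeConjecture.Theorems.F0P3cStCharTSWeylFixedIffNormTrivial -- ★ `cmWeylTorusCharPair_eq_of_apply_fixed_eq_one` (case (3): `wθ̃ = θ̃`)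
import Summits.HodgeConjecture.HodgeConjecture.Theorems.F0P3cStCharTSLdsTwoOfTwo           -- ★ p852080 (LH6-p05): `exists_ne_of_card_two` (finset logic: the packet itself witnesses «two distinct constituents»)
import Literature.NumberTheory.Automorphic.U3LocalBruhatDecompositionProofs                 -- ★ F1 `U3LocalBruhatDecomposition_holds` (the Bruhat element `w₀`, matrix `Φ₃`)
import Literature.NumberTheory.Automorphic.CMBorelWeylTorusConjugate                        -- ★ `weylConj_mem_cmTorus`, `cmTorusCharPair_weylConj` (`θ̃(ʷt) = (wθ̃)(t)`)
import Literature.NumberTheory.Automorphic.CMPrincipalSeriesJacquetEvalOne                  -- ★ `continuous_cmTorusCharPair_apply`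
import Literature.NumberTheory.Automorphic.UnitaryGroupBorelInduction                        -- ★ `cmPrincipalSeries`, `cmTorusCharPair` (the PAIR currency of the field equation `hLds`)
import HarnessLib

/-!
# F0 · P3c · «StCharTS» K4′ column — E1 ROW 68-I-NW «K4′ NOT-WILD∕TAME HEAD»: text 4 `hLdsOne` of the organ (S-𝔑) — `⟨χ_π, χ_π⟩_e = 1` for every member `π` of every l.d.s.
# packet `Π(θ) = JH(i_B(θ̃))` of `U(Φ₃)(L⁺_v)` — at every NOT-WILD non-split place `v` (`v` unramified in `L` or `|2|_v = 1`), from the FIELD EQUATION `hLds` alone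
# [Rogawski1990, §12.6 Prop. 12.6.1 (a) p. 188; §12.2 (3) pp. 173–174]

Cell `pub/hodgecm-mathlib` (D-0151), crux H413 = `stmt-HodgeConjecture-24833` (`--supports … --as helper` lane); seat «LH5» LH5-p04 (g12), dealt BY NAME by E1 keeper ∕ dealer
F0P3a-p03 (g31) k83∕k84 («68-I-NW = 68-I's head with `hunr ↦ hv` and nothing else; body = (S0) unpack + representative + `hsplit := 68-H …` + ONE call of row 73 §NW»).  The
NOT-WILD twin of the K4′-UNR head 68-I `F0P3cStCharTSK4PrimeUnr.innerG_char_self_eq_one_of_mem_ldsPackets_of_unramified` (F0P3a-p04 (g33) skeleton ∕ F0P3b-p01 (g26) column,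
CENSUS-R68 v1 607db827; LEAD F0P3a-plan (g16) T15-54 (B)).  THEOREMS ONLY (no definition ∕ instance ∕ notation ∕ named fact ∕ `sorry`).  HONEST LABEL: count-neutral helper
(rider-class until the LEAD prices the organ edition `hLdsOne ↦ hLdsOneW`); TAME road GO-LOW (T15-42), WILD (`v ∣ 2`) = PRINT of record; E1 = PRINT; h413 OPEN; HC_CM is proved only
modulo the 7 printed citations (2 remaining named inputs: hLiu418 = stmt-HodgeConjecture-24832, h413 = stmt-HodgeConjecture-24833) until rung 0 closes.  Nothing printed is asserted here.

TARGET (text 4 = `hLdsOne` of (S-𝔑) `hBlock′`, SERVED leaf `Cruxes/H413/Lines/F0_P3c_StCharTSPaydown.lean` :480–481, VERBATIM): `∀ P ∈ 𝔇.ldsPackets, ∀ π ∈ P,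
𝔇.innerG (𝔇.char π) (𝔇.char π) = 1` — proved here under the NOT-WILD place token `hv` from the field equation `hLds` (leaf :267, the junction's `hLdsF`) and ★ inputs only.

THE PROOF ((S0) of CENSUS-R68 §1, then ONE call).  Unpack `(hLds P).1 hP`: `P.card = 2` and `P` is exactly the set of constituents of `I₀ = i_G(χ₁, χ₂)` for continuous `χ₁, χ₂`
with `χ₁` trivial on the `σ`-fixed units (case (3)).  So the member `π` is a constituent of `I₀` (`hc`), and THE PACKET ITSELF witnesses «`I₀` has two distinct constituents»
(`htwo`, ★ `LdsTwoOfTwo.exists_ne_of_card_two` — finset logic; NO organ letter `hLdsRedTwo`∕`hLdsTwo` is consumed).  For a representative `r` of `π` (`IrrClass.ind`), ★ 68-H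
`F0P3cStCharTSLdsSelfExtSplit.forall_smooth_selfExtension_split_of_mem_lds … htwo … (IrrClass.mk r) hc r rfl` («K4′ SPLIT @ DATUM», place-free: every smooth self-extension of `r.ρ`
splits — the (J)-road ★ 46‴ ∕ (O1) ∕ (O2) ∕ 68-A∕B∕C∕γ′ ∕ 63-D underneath) is EXACTLY the `hsplit` binder of ★ row 73 §NW
`F0P3cStCharTSEPNormOneOfHsplit.innerG_char_self_eq_one_of_hsplit_of_not_wild L v hns hv ‹junction letters› r hsplit` («HSPLIT ⇒ EP-NORM-ONE», NOT-WILD token: the ★ (G3)-NOT-WILD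
case split over the unramified trunk ★ 59-F ED. 2 and the tame trunk ★ 72-NW §A-RAM, with ★ 58 S2a ∕ ★ 58-W-RAM pseudo-coefficients and ★ 61b ∕ 61b-RAM inside).
* BINDER-FREE (ONE edition, keeper F0P3a-p03 (g32) k06): ★ 68-H's only non-★ binders are fed BY NAME here — `htwo` from the field equation at the packet (above) and
  the open-cell jet datum `hGLd := ★ (M5) F0P3cStCharTSJetDatumHGL.hGLd_cmBorel L v hns w₀ hw₀ θ̃ hθc (𝟙 ⊗ θ̃) hχL hθw (★ (L) additive_weylConj_eq_neg L v w hw w₀ hw₀)` with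
  `w ∣ v` any place, `w₀` the Bruhat element (★ F1 `U3LocalBruhatDecomposition_holds`), `θ̃ := cmTorusCharPair L v χ₁ χ₂` continuous (★ `continuous_cmTorusCharPair_apply`),
  `(𝟙 ⊗ θ̃) m x = θ̃(m)·x` (★ 68-H `twist_trivial_apply`) and `θ̃(ʷm) = θ̃(m)` (★ `cmTorusCharPair_weylConj` + ★ `cmWeylTorusCharPair_eq_of_apply_fixed_eq_one` from `htriv`,
  case (3)).  Organ-facing signature = the K4′-UNR head 68-I's (F0P3a-p04 (g33)) with `hunr ↦ hv` (the 2a′ disjunction) and NOTHING else (k84∕k89∕k91∕k102; row 69 ∕ k10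
  acceptance test): `(hns) (hv) «J» (hLds) : ∀ P ∈ 𝔇.ldsPackets, ∀ π ∈ P, 𝔇.innerG (𝔇.char π) (𝔇.char π) = 1`.
[cite: Rogawski1990, §12.6 Prop. 12.6.1 (a) p. 188] [cite: Rogawski1990, §12.2 (3) pp. 173–174] [cite: SchneiderStuhler1997, §III.4] [cite: Kottwitz1988, §2] [cite: Keys1984, §7 Thm. p. 126]

## References
* [Rogawski1990] J. D. Rogawski, *Automorphic Representations of Unitary Groups in Three Variables*, Ann. of Math. Stud. 123 (1990), §12.2 (3) pp. 173–174, §12.5 pp. 182–187, §12.6 Prop. 12.6.1 (a) p. 188.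
* [Keys1984] D. Keys, *Principal series representations of special unitary groups over local fields*, Compositio Math. 51 (1984), §3 pp. 118–119, §4 Thm. 3 p. 120, §7 Thm. p. 126.
* [SchneiderStuhler1997] P. Schneider, U. Stuhler, *Representation theory and sheaves on the Bruhat–Tits building*, Publ. Math. IHÉS 85 (1997), §III.4, Thm. III.4.16.
* [Kottwitz1988] R. Kottwitz, *Tamagawa numbers*, Ann. of Math. 127 (1988), §2.
* [BruhatTits1972] F. Bruhat, J. Tits, *Groupes réductifs sur un corps local I*, Publ. Math. IHÉS 41 (1972), §10.
-/

set_option autoImplicit false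
-- the mandated namespace has the single-problem summit's repeated segment (`HodgeConjecture.HodgeConjecture`)
set_option linter.dupNamespace false

noncomputable section

open NumberField IsDedekindDomain MeasureTheory Filter Topology
open scoped Matrix MatrixGroups Pointwise Valued WithZero ComplexConjugate
open Literature.NumberTheory.Rogawski1990 Literature.NumberTheory.Rogawski1990.Ch12Sec5
open Literature.NumberTheory.Automorphic Literature.NumberTheory.Automorphic.UnitaryGroup Literature.NumberTheory.Automorphic.UnitaryLatticeTree
open Literature.NumberTheory.Automorphic.HermitianLattice
open Literature.NumberTheory.GaloisRepresentations

namespace Summit.HodgeConjecture.HodgeConjecture.Cruxes.H413.F0P3cStCharTSK4PrimeNotWild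

open Summit.HodgeConjecture.HodgeConjecture.Cruxes.H413
open Summit.HodgeConjecture.HodgeConjecture.Cruxes.H413.F0P3cStCharTSTorusDefs
open Summit.HodgeConjecture.HodgeConjecture.Cruxes.H413.F0P3cStCharTSLdsTwoOfTwo (exists_ne_of_card_two)

variable (L : Type) [Field L] [NumberField L] [IsCMField L] (v : HeightOneSpectrum (𝓞 ↥(maximalRealSubfield L)))

/-! ## ROW 68-I-NW «K4′ NOT-WILD∕TAME HEAD» — text 4 `hLdsOne` under the NOT-WILD token, from the field equation `hLds` and ★ inputs only (binder-free) -/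

set_option synthInstance.maxHeartbeats 400000 in
set_option maxHeartbeats 1600000 in
-- 8× default (= ★ 58 S2b ∕ ★ 73 §U class), MEASURED: RED at the default 200 000 (`isDefEq` in the `hθw` transport of ★ `cmTorusCharPair_weylConj` across the
-- `↥(cmBorelTriple L 3 v).M` ∕ `↥(torusU …)` spellings), GREEN at 1 600 000 in 29 s by import; the ★ (M5) ∕ ★ 68-H DATUM calls instantiate their CM-carrier heads once each
/-- **ROW 68-I-NW «K4′ NOT-WILD∕TAME HEAD».**  At a non-split NOT-WILD place `v` (`hv : v unramified in L ∨ |2|_v = 1`), at a §12.5 datum `𝔇` with the junction pins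
`hμG horb hreg hE hM1` and ★ PCT-OUT's letters `hWIF hC1 hC2 hC3 hL2`, whose l.d.s. packets satisfy the FIELD EQUATION `hLds` (print's `Π(θ) = JH(i_B(θ̃))`, `θ` semi-regular, in
the PAIR currency; leaf :267 `hLdsF` VERBATIM): **for every l.d.s. packet `P` and every `π ∈ P`, `⟨χ_π, χ_π⟩_e = 1`** — text 4 `hLdsOne` of (S-𝔑) with its antecedents VERBATIM.
Proof: unpack `hLds P` (the member is a constituent of `i_G(χ₁, χ₂)`, case (3); the packet witnesses two distinct constituents, ★ `exists_ne_of_card_two`), take a representative `r`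
(`IrrClass.ind`), `hsplit := ★ 68-H F0P3cStCharTSLdsSelfExtSplit.forall_smooth_selfExtension_split_of_mem_lds … htwo hGLd (IrrClass.mk r) hc r rfl` («K4′ SPLIT @ DATUM», its
open-cell jet datum `hGLd` fed by ★ (M5) `hGLd_cmBorel` over the Bruhat element `w₀`, `θ̃` continuous, `θ̃(ʷm) = θ̃(m)` (case (3)) and ★ (L) `additive_weylConj_eq_neg`), then ★ row 73
§NW `innerG_char_self_eq_one_of_hsplit_of_not_wild`.  ZERO hypothesis binders beyond the junction letters and the field equation.  Organ-facing
signature = the K4′-UNR head 68-I's with `hunr ↦ hv` and NOTHING else; NO `¬ IsSupercuspidal` guard (both members are principal-series constituents), NO `hLdsRedTwo`∕`hLdsTwo`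
letter (idle: `htwo` comes from `hLds` at the packet), NO unitarity ∕ `IsL2` ∕ `IsEllipticRep` letter.
[cite: Rogawski1990, §12.6 Prop. 12.6.1 (a) p. 188] [cite: Rogawski1990, §12.2 (3) pp. 173–174] [cite: Keys1984, §7 Thm. p. 126] [cite: SchneiderStuhler1997, §III.4] [cite: Kottwitz1988, §2] -/
theorem innerG_char_self_eq_one_of_mem_ldsPackets_of_not_wild
    (hns : ∀ w : PlacesOver L v, IsCMField.complexConj L • w.1 = w.1) (hv : Algebra.IsUnramifiedIn (𝓞 L) v.asIdeal ∨ Valued.v (2 : v.adicCompletion ↥(maximalRealSubfield L)) = 1)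
    [MeasurableSpace (Gqs L v)] [BorelSpace (Gqs L v)]
    [∀ γ : Gqs L v, MeasurableSpace (Gqs L v ⧸ Subgroup.centralizer ({γ} : Set (Gqs L v)))] [∀ γ : Gqs L v, BorelSpace (Gqs L v ⧸ Subgroup.centralizer ({γ} : Set (Gqs L v)))]
    [MeasurableSpace (Gqs L v ⧸ Subgroup.center (Gqs L v))]
    {H : Type} [Group H] [TopologicalSpace H] [IsTopologicalGroup H] [MeasurableSpace H]
    (νQv : Measure (Gqs L v)) [νQv.IsHaarMeasure] [νQv.IsMulRightInvariant] (mQv : OrbitalMeasureFamily (Gqs L v))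
    (hcanQ : mQv.IsCanonical (fun γ => IsRegularElt (γ.val : GL (Fin 3) (UnitaryGroup.LocalRing L v))) νQv)
    (𝔇 : EllipticData (Gqs L v) H) (hμG : 𝔇.μG = νQv) (horb : 𝔇.orb = mQv)
    (hreg : ∀ γ : Gqs L v, γ ∈ 𝔇.regG ↔ IsRegularElt (γ.val : GL (Fin 3) (UnitaryGroup.LocalRing L v)))
    (hE : ∀ γ : Gqs L v, γ ∈ 𝔇.ellG ↔ IsRegularElt (γ.val : GL (Fin 3) (UnitaryGroup.LocalRing L v)) ∧ γ ∉ hyperbolicSet L v)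
    (hM1 : ∀ π : IrrClass (Gqs L v), Measurable (𝔇.char π) ∧ LocallyIntegrable (𝔇.char π) 𝔇.μG ∧ (∀ x ∈ 𝔇.regG, ∀ᶠ y in 𝓝 x, 𝔇.char π y = 𝔇.char π x) ∧
      ∀ φ : Gqs L v → ℂ, IsLocSmooth φ → π.smoothTrace 𝔇.μG φ = ∫ x, φ x * 𝔇.char π x ∂𝔇.μG)
    (hWIF : 𝔇.WeylIntegrationFormula) (hC1 : 𝔇.EllCartanSubset) (hC2 : 𝔇.EllCartanAE) (hC3 : 𝔇.NonEllCartanAE) (hL2 : 𝔇.L2CharOnTorusAll)   -- ★ PCT-OUT's extra letters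
    -- the l.d.s. FIELD EQUATION (leaf :267 `hLdsF` VERBATIM)
    (hLds : ∀ P : Finset (IrrClass (Gqs L v)), P ∈ 𝔇.ldsPackets ↔ (P.card = 2 ∧ ∃ (χ₁ : (UnitaryGroup.LocalRing L v)ˣ →* ℂˣ) (χ₂ : ↥(normOneUnits (conjLocal L (IsCMField.complexConj L) v)) →* ℂˣ), Continuous (fun x => ((χ₁ x : ℂˣ) : ℂ)) ∧ Continuous (fun x => ((χ₂ x : ℂˣ) : ℂ)) ∧ (∀ a : (UnitaryGroup.LocalRing L v)ˣ, (conjLocal L (IsCMField.complexConj L) v) (a : UnitaryGroup.LocalRing L v) = a → χ₁ a = 1) ∧ χ₁ ≠ 1 ∧ ∀ c : IrrClass (Gqs L v), c ∈ P ↔ c.IsConstituentOf (UnitaryGroup.cmPrincipalSeries L 3 v (UnitaryGroup.cmTorusCharPair L v χ₁ χ₂)))) :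
    ∀ P ∈ 𝔇.ldsPackets, ∀ π ∈ P, 𝔇.innerG (𝔇.char π) (𝔇.char π) = 1 := by
  intro P hP π hπ
  -- (S0) unpack the field equation at the packet: case (3) characters, the member is a constituent, the packet witnesses two distinct constituents
  obtain ⟨hcard, χ₁, χ₂, hc1, hc2, htriv, -, hmem⟩ := (hLds P).1 hP
  have hc : π.IsConstituentOf (UnitaryGroup.cmPrincipalSeries L 3 v (UnitaryGroup.cmTorusCharPair L v χ₁ χ₂)) := (hmem π).1 hπ
  have htwo : ∃ c₁ c₂ : IrrClass (Gqs L v), c₁ ≠ c₂ ∧ c₁.IsConstituentOf (UnitaryGroup.cmPrincipalSeries L 3 v (UnitaryGroup.cmTorusCharPair L v χ₁ χ₂)) ∧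
      c₂.IsConstituentOf (UnitaryGroup.cmPrincipalSeries L 3 v (UnitaryGroup.cmTorusCharPair L v χ₁ χ₂)) :=
    exists_ne_of_card_two ⟨P, hcard, hmem⟩
  clear hmem hπ hP hcard
  -- the open-cell jet datum `hGLd` of ★ 68-H at the packet's `(χ₁, χ₂)` by ★ (M5): a place `w ∣ v`, the Bruhat element `w₀ = Φ₃` (★ F1, read stepwise), `θ̃` continuous,
  -- `χL := 𝟙 ⊗ θ̃`, `θ̃(ʷm) = θ̃(m)` (case (3): `wθ̃ = θ̃` from `htriv`), and ★ (L) `λ(ʷm) = −λ(m)`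
  obtain ⟨w⟩ : Nonempty (PlacesOver L v) := inferInstance
  have H0 := U3LocalBruhatDecomposition_holds L v
  obtain ⟨w₀, hw₀, -, -, -⟩ := H0 hns
  have hθc : Continuous fun x : ↥(cmBorelTriple L 3 v).M => ((cmTorusCharPair L v χ₁ χ₂ x : ℂˣ) : ℂ) :=
    continuous_cmTorusCharPair_apply L v χ₁ χ₂ hc1 hc2
  have hχL : ∀ (m : ↥(cmBorelTriple L 3 v).M) (x : ℂ),
      ((Representation.trivial ℂ ↥(cmBorelTriple L 3 v).M ℂ).twist (cmTorusCharPair L v χ₁ χ₂)) m x = (cmTorusCharPair L v χ₁ χ₂ m : ℂ) * x :=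
    F0P3cStCharTSLdsSelfExtSplit.twist_trivial_apply (cmTorusCharPair L v χ₁ χ₂)
  have hwfix : cmWeylTorusCharPair L v χ₁ χ₂ = cmTorusCharPair L v χ₁ χ₂ :=
    F0P3cStCharTSWeylFixedIffNormTrivial.cmWeylTorusCharPair_eq_of_apply_fixed_eq_one L v χ₁ χ₂ htriv
  have hθw : ∀ m : ↥(cmBorelTriple L 3 v).M, cmTorusCharPair L v χ₁ χ₂
      ⟨w₀ * (m : ↥(unitaryGroupOfForm (conjLocal L (IsCMField.complexConj L) v) (cmLocalForm L 3 v))) * w₀⁻¹, weylConj_mem_cmTorus L v w₀ hw₀ m⟩ = cmTorusCharPair L v χ₁ χ₂ m := by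
    intro m
    have h := cmTorusCharPair_weylConj L v w₀ hw₀ χ₁ χ₂ m
    rw [hwfix] at h
    exact h
  have hGLd := F0P3cStCharTSJetDatumHGL.hGLd_cmBorel L v hns w₀ hw₀ (cmTorusCharPair L v χ₁ χ₂) hθc
    ((Representation.trivial ℂ ↥(cmBorelTriple L 3 v).M ℂ).twist (cmTorusCharPair L v χ₁ χ₂)) hχL hθw
    (F0P3cStCharTSAdditiveCharLine.additive_weylConj_eq_neg L v w (hns w) w₀ hw₀)
  -- a representative `r` of the member, `hsplit` from ★ 68-H at the datum, then the ★ row 73 socket under the NOT-WILD token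
  induction π using IrrClass.ind with
  | h r =>
  exact F0P3cStCharTSEPNormOneOfHsplit.innerG_char_self_eq_one_of_hsplit_of_not_wild L v hns hv νQv mQv hcanQ 𝔇 hμG horb hreg hE hM1 hWIF hC1 hC2 hC3 hL2 r
    (F0P3cStCharTSLdsSelfExtSplit.forall_smooth_selfExtension_split_of_mem_lds L v hns χ₁ χ₂ hc1 hc2 htriv htwo hGLd (IrrClass.mk r) hc r rfl)

end Summit.HodgeConjecture.HodgeConjecture.Cruxes.H413.F0P3cStCharTSK4PrimeNotWild

end
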